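import Mathlib
import Literature.Analysis.FluidPDE.VectorCalculus
import Literature.Geometry.DiscreteGeometry.LayerShells
import Summits.NavierStokesRegularity.NavierStokesRegularity.Theorems.ThreadingFluxHorizonTowerDefs
import HarnessLib

/-!
# Crux `PoloidalLiouville` (stmt-NavierStokesRegularity-1222, wall W1), crux idea «horizon-threading-tower» (ns-idea-15):
# from infinitesimal rotation invariance to the ZONAL FUNCTIONAL FORM `H(y) = ‖y‖^l g(⟪n,y⟫/‖y‖)`

Support file (Theorems-side tooling, `--supports stmt-NavierStokesRegularity-1222 --as helper`; seat ns-wall-eng-7 g3, cell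
ns-wall-extremal, item HT1-CERT-CORE).  The conclusion of `HorizonTower.HorizonZonalitySingleDegree` (and of `HorizonTowerZonality`)
is a FUNCTIONAL FORM: `∃ a ≠ 0, ∃ g, H y = ‖y‖^l · g(⟪a,y⟫/‖y‖)` off the origin.  Algebraic certificates (the engines' B-ht1 cells, the
kernel certificate `CubicCert.exists_axis_of_gensVanish`) deliver instead an AXIS `n ≠ 0` with `⟪n × p, ∇H(p)⟫ = 0` for all `p`
(infinitesimal rotation invariance).  This file proves, for every degree `l`, the generic bridge between the two:

* `HorizonTower.eq_of_inner_cross_gradient_eq_zero` — a differentiable `H : ℝ³ → ℝ` with `⟪n × p, ∇H p⟫ = 0` for all `p`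
  (`‖n‖ = 1`) takes equal values at any two points with the same norm and the same height `⟪n,·⟫` (it is constant on the circles
  about the axis: the rotation path `θ ↦ c n + cos θ w + sin θ (n × w)` has velocity `n × γ(θ)`, so `H ∘ γ` has zero derivative);
* `HorizonTower.exists_zonalForm_of_inner_cross_gradient_eq_zero` — if moreover `H (c • y) = c ^ l * H y` for `c > 0`, then
  `∃ g, ∀ y ≠ 0, H y = ‖y‖ ^ l * g (⟪n, y⟫ / ‖y‖)` (any `n ≠ 0`).

Pure calculus on `ℝ³` (no PDE; coordinates via the tree's `Literature.Geometry.DiscreteGeometry.inner_fin3`); information-grade for W1/W2; `PoloidalLiouville` (1222) / NS regularity remain OPEN and untouched.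
[cite: MajdaBertozziCUP2002, §1.1 (vector identities)] for the cross-product algebra; the rest is [folklore].
-/

-- the summit and its single problem share the name (D-0017 nested layout)
set_option linter.dupNamespace false

noncomputable section

open scoped RealInnerProductSpace
open Literature.Analysis.FluidPDE (cross)
open Literature.Geometry.DiscreteGeometry (inner_fin3)

namespace Summit.NavierStokesRegularity.NavierStokesRegularity.Theorems.PoloidalLiouville.HorizonTower

/-- The tree's cross product on `ℝ³` in coordinates. [folklore] -/
theorem cross_fin3 (a b : E3) :
    cross a b 0 = a 1 * b 2 - a 2 * b 1 ∧ cross a b 1 = a 2 * b 0 - a 0 * b 2 ∧ cross a b 2 = a 0 * b 1 - a 1 * b 0 := by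
  simp only [cross, PiLp.toLp_apply, cross_apply, Matrix.cons_val_zero, Matrix.cons_val_one, Matrix.cons_val_two,
    Matrix.head_cons, Matrix.tail_cons]
  exact ⟨trivial, trivial, trivial⟩

/-- `⟪∇H(p), v⟫ = DH(p)[v]` (Riesz). [folklore] -/
theorem inner_gradient_eq_fderiv (H : E3 → ℝ) (p v : E3) : ⟪gradient H p, v⟫ = fderiv ℝ H p v := by
  rw [gradient, InnerProductSpace.toDual_symm_apply]

/-- The rotation path about a unit axis `n` through `c n + w` (`w ⊥ n`): `γ(θ) = c n + cos θ w + sin θ (n × w)`; its velocity is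
the infinitesimal rotation `n × γ(θ)`. [cite: MajdaBertozziCUP2002, §1.1 (vector identities)] -/
theorem hasDerivAt_rotationPath {n w : E3} (hn : ⟪n, n⟫ = 1) (hw : ⟪n, w⟫ = 0) (c θ : ℝ) :
    HasDerivAt (fun t : ℝ => c • n + Real.cos t • w + Real.sin t • cross n w)
      (cross n (c • n + Real.cos θ • w + Real.sin θ • cross n w)) θ := by
  have h : HasDerivAt (fun t : ℝ => c • n + Real.cos t • w + Real.sin t • cross n w)
      ((0 : E3) + (-Real.sin θ) • w + Real.cos θ • cross n w) θ :=
    ((hasDerivAt_const θ (c • n)).add ((Real.hasDerivAt_cos θ).smul_const w)).add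
      ((Real.hasDerivAt_sin θ).smul_const (cross n w))
  rw [zero_add] at h
  convert h using 1
  rw [inner_fin3] at hn hw
  obtain ⟨c0, c1, c2⟩ := cross_fin3 n w
  obtain ⟨d0, d1, d2⟩ := cross_fin3 n (c • n + Real.cos θ • w + Real.sin θ • cross n w)
  ext i
  fin_cases i
  · simp only [Fin.zero_eta, Fin.isValue, PiLp.add_apply, PiLp.smul_apply, smul_eq_mul, d0, c0, c1, c2]
    linear_combination (Real.sin θ * n 0) * hw - (Real.sin θ * w 0) * hn
  · simp only [Fin.mk_one, Fin.isValue, PiLp.add_apply, PiLp.smul_apply, smul_eq_mul, d1, c0, c1, c2]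
    linear_combination (Real.sin θ * n 1) * hw - (Real.sin θ * w 1) * hn
  · simp only [Fin.reduceFinMk, Fin.isValue, PiLp.add_apply, PiLp.smul_apply, smul_eq_mul, d2, c0, c1, c2]
    linear_combination (Real.sin θ * n 2) * hw - (Real.sin θ * w 2) * hn

/-- Along the rotation path an infinitesimally rotation-invariant differentiable `H` is constant. [folklore] -/
theorem apply_rotationPath_eq {H : E3 → ℝ} {n w : E3} (hH : Differentiable ℝ H)
    (hrot : ∀ p : E3, ⟪cross n p, gradient H p⟫ = 0) (hn : ⟪n, n⟫ = 1) (hw : ⟪n, w⟫ = 0) (c θ : ℝ) :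
    H (c • n + Real.cos θ • w + Real.sin θ • cross n w) = H (c • n + w) := by
  have hd : ∀ t, HasDerivAt (H ∘ fun t : ℝ => c • n + Real.cos t • w + Real.sin t • cross n w) 0 t := by
    intro t
    have h1 := ((hH (c • n + Real.cos t • w + Real.sin t • cross n w)).hasFDerivAt).comp_hasDerivAt t
      (hasDerivAt_rotationPath hn hw c t)
    have h2 : fderiv ℝ H (c • n + Real.cos t • w + Real.sin t • cross n w)
        (cross n (c • n + Real.cos t • w + Real.sin t • cross n w)) = 0 := by
      rw [← inner_gradient_eq_fderiv, real_inner_comm]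
      exact hrot _
    rw [h2] at h1
    exact h1
  have hdiff : Differentiable ℝ (H ∘ fun t : ℝ => c • n + Real.cos t • w + Real.sin t • cross n w) :=
    fun t => (hd t).differentiableAt
  have hconst := is_const_of_deriv_eq_zero hdiff (fun t => (hd t).deriv) θ 0
  simpa using hconst

/-- Decomposition in the plane orthogonal to a unit axis: for `‖n‖ = 1`, `w ⊥ n`, `v ⊥ n`:
`‖w‖² v = ⟪w, v⟫ w + ⟪n × w, v⟫ (n × w)`. [cite: MajdaBertozziCUP2002, §1.1 (vector identities)] -/
theorem orthogonal_plane_decomposition {n w v : E3} (hn : ⟪n, n⟫ = 1) (hw : ⟪n, w⟫ = 0) (hv : ⟪n, v⟫ = 0) :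
    ⟪w, w⟫ • v = ⟪w, v⟫ • w + ⟪cross n w, v⟫ • cross n w := by
  rw [inner_fin3] at hn hw hv
  obtain ⟨c0, c1, c2⟩ := cross_fin3 n w
  rw [inner_fin3 w w, inner_fin3 w v, inner_fin3 (cross n w) v, c0, c1, c2]
  ext i
  fin_cases i
  · simp only [Fin.zero_eta, Fin.isValue, PiLp.add_apply, PiLp.smul_apply, smul_eq_mul, c0]
    linear_combination (-((w 0 * w 0 + w 1 * w 1 + w 2 * w 2) * v 0 - (w 0 * v 0 + w 1 * v 1 + w 2 * v 2) * w 0)) * hn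
      + ((n 0 * w 0 + n 1 * w 1 + n 2 * w 2) * v 0 - (w 0 * v 0 + w 1 * v 1 + w 2 * v 2) * n 0
          - (n 0 * v 0 + n 1 * v 1 + n 2 * v 2) * w 0) * hw
      + ((w 0 * w 0 + w 1 * w 1 + w 2 * w 2) * n 0) * hv
  · simp only [Fin.mk_one, Fin.isValue, PiLp.add_apply, PiLp.smul_apply, smul_eq_mul, c1]
    linear_combination (-((w 0 * w 0 + w 1 * w 1 + w 2 * w 2) * v 1 - (w 0 * v 0 + w 1 * v 1 + w 2 * v 2) * w 1)) * hn
      + ((n 0 * w 0 + n 1 * w 1 + n 2 * w 2) * v 1 - (w 0 * v 0 + w 1 * v 1 + w 2 * v 2) * n 1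
          - (n 0 * v 0 + n 1 * v 1 + n 2 * v 2) * w 1) * hw
      + ((w 0 * w 0 + w 1 * w 1 + w 2 * w 2) * n 1) * hv
  · simp only [Fin.reduceFinMk, Fin.isValue, PiLp.add_apply, PiLp.smul_apply, smul_eq_mul, c2]
    linear_combination (-((w 0 * w 0 + w 1 * w 1 + w 2 * w 2) * v 2 - (w 0 * v 0 + w 1 * v 1 + w 2 * v 2) * w 2)) * hn
      + ((n 0 * w 0 + n 1 * w 1 + n 2 * w 2) * v 2 - (w 0 * v 0 + w 1 * v 1 + w 2 * v 2) * n 2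
          - (n 0 * v 0 + n 1 * v 1 + n 2 * v 2) * w 2) * hw
      + ((w 0 * w 0 + w 1 * w 1 + w 2 * w 2) * n 2) * hv

/-- Lagrange's identity in the plane orthogonal to a unit axis: for `‖n‖ = 1`, `w ⊥ n`, `v ⊥ n`:
`‖w‖² ‖v‖² = ⟪w, v⟫² + ⟪n × w, v⟫²`. [cite: MajdaBertozziCUP2002, §1.1 (vector identities)] -/
theorem orthogonal_plane_lagrange {n w v : E3} (hn : ⟪n, n⟫ = 1) (hw : ⟪n, w⟫ = 0) (hv : ⟪n, v⟫ = 0) :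
    ⟪w, w⟫ * ⟪v, v⟫ = ⟪w, v⟫ ^ 2 + ⟪cross n w, v⟫ ^ 2 := by
  rw [inner_fin3] at hn hw hv
  obtain ⟨c0, c1, c2⟩ := cross_fin3 n w
  rw [inner_fin3 w w, inner_fin3 v v, inner_fin3 w v, inner_fin3 (cross n w) v, c0, c1, c2]
  linear_combination (-((w 0 * w 0 + w 1 * w 1 + w 2 * w 2) * (v 0 * v 0 + v 1 * v 1 + v 2 * v 2)
        - (w 0 * v 0 + w 1 * v 1 + w 2 * v 2) ^ 2)) * hn
    + (-2 * (w 0 * v 0 + w 1 * v 1 + w 2 * v 2) * (n 0 * v 0 + n 1 * v 1 + n 2 * v 2)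
        + (v 0 * v 0 + v 1 * v 1 + v 2 * v 2) * (n 0 * w 0 + n 1 * w 1 + n 2 * w 2)) * hw
    + ((w 0 * w 0 + w 1 * w 1 + w 2 * w 2) * (n 0 * v 0 + n 1 * v 1 + n 2 * v 2)) * hv

/-- **Circle constancy.**  A differentiable `H : ℝ³ → ℝ` with `⟪n × p, ∇H(p)⟫ = 0` for all `p` (`n` a unit vector) takes the same
value at any two points with equal norms and equal heights `⟪n, ·⟫`. [folklore] -/
theorem eq_of_inner_cross_gradient_eq_zero {H : E3 → ℝ} {n : E3} (hH : Differentiable ℝ H)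
    (hrot : ∀ p : E3, ⟪cross n p, gradient H p⟫ = 0) (hn : ‖n‖ = 1) {y y' : E3} (hnorm : ‖y‖ = ‖y'‖)
    (hinner : ⟪n, y⟫ = ⟪n, y'⟫) : H y = H y' := by
  have hn1 : ⟪n, n⟫ = 1 := by rw [real_inner_self_eq_norm_sq, hn, one_pow]
  obtain ⟨c, hc⟩ : ∃ c : ℝ, c = ⟪n, y⟫ := ⟨_, rfl⟩
  obtain ⟨w, hw_def⟩ : ∃ w : E3, w = y - c • n := ⟨_, rfl⟩
  obtain ⟨w', hw'_def⟩ : ∃ w' : E3, w' = y' - c • n := ⟨_, rfl⟩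
  have hw : ⟪n, w⟫ = 0 := by rw [hw_def, inner_sub_right, inner_smul_right, hn1, ← hc]; ring
  have hw' : ⟪n, w'⟫ = 0 := by rw [hw'_def, inner_sub_right, inner_smul_right, hn1, ← hinner, ← hc]; ring
  have hy : y = c • n + w := by rw [hw_def]; abel
  have hy' : y' = c • n + w' := by rw [hw'_def]; abel
  -- the two in-plane components have the same length
  have hww : ⟪w', w'⟫ = ⟪w, w⟫ := by
    have e1 : ⟪w, w⟫ = ‖y‖ ^ 2 - c ^ 2 := by
      rw [hw_def, real_inner_self_eq_norm_sq, norm_sub_sq_real, norm_smul, Real.norm_eq_abs, hn, mul_one, sq_abs,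
        inner_smul_right, real_inner_comm, ← hc]; ring
    have e2 : ⟪w', w'⟫ = ‖y'‖ ^ 2 - c ^ 2 := by
      rw [hw'_def, real_inner_self_eq_norm_sq, norm_sub_sq_real, norm_smul, Real.norm_eq_abs, hn, mul_one, sq_abs,
        inner_smul_right, real_inner_comm, ← hinner, ← hc]; ring
    rw [e1, e2, hnorm]
  rcases eq_or_ne w 0 with hw0 | hw0
  · -- degenerate circle: both points are `c n`
    have : w' = 0 := by
      have h0 : ⟪w', w'⟫ = 0 := by rw [hww, hw0, inner_zero_left]
      exact inner_self_eq_zero.mp h0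
    rw [hy, hy', hw0, this]
  · -- rotate `w` onto `w'` inside the plane orthogonal to `n`
    have hρ : ⟪w, w⟫ ≠ 0 := fun h => hw0 (inner_self_eq_zero.mp h)
    obtain ⟨α, hα⟩ : ∃ α : ℝ, α = ⟪w, w'⟫ / ⟪w, w⟫ := ⟨_, rfl⟩
    obtain ⟨β, hβ⟩ : ∃ β : ℝ, β = ⟪cross n w, w'⟫ / ⟪w, w⟫ := ⟨_, rfl⟩
    have hdec : w' = α • w + β • cross n w := by
      have h := orthogonal_plane_decomposition hn1 hw hw'
      have h2 : w' = (⟪w, w⟫)⁻¹ • (⟪w, w⟫ • w') := by rw [smul_smul, inv_mul_cancel₀ hρ, one_smul]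
      rw [h2, h, smul_add, smul_smul, smul_smul, hα, hβ, div_eq_inv_mul, div_eq_inv_mul]
    have hcircle : α ^ 2 + β ^ 2 = 1 := by
      have h := orthogonal_plane_lagrange hn1 hw hw'
      rw [hww] at h
      rw [hα, hβ, div_pow, div_pow, ← add_div, ← h, div_eq_one_iff_eq (pow_ne_zero 2 hρ)]
      ring
    -- an angle with `cos θ = α`, `sin θ = β`
    obtain ⟨θ, hθ⟩ : ∃ θ : ℝ, Complex.exp (θ * Complex.I) = ⟨α, β⟩ := by
      rw [← Complex.norm_eq_one_iff, Complex.norm_eq_sqrt_sq_add_sq]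
      simp [hcircle]
    have hcos : Real.cos θ = α := by
      have := congrArg Complex.re hθ
      simpa [Complex.exp_ofReal_mul_I_re] using this
    have hsin : Real.sin θ = β := by
      have := congrArg Complex.im hθ
      simpa [Complex.exp_ofReal_mul_I_im] using this
    have key := apply_rotationPath_eq hH hrot hn1 hw c θ
    rw [hcos, hsin, add_assoc, ← hdec, ← hy', ← hy] at key
    exact key.symm

/-- `(c • n) × p = c • (n × p)`, coordinatewise. [cite: MajdaBertozziCUP2002, §1.1 (vector identities)] -/
theorem cross_smul_left (c : ℝ) (n p : E3) : cross (c • n) p = c • cross n p := by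
  obtain ⟨c0, c1, c2⟩ := cross_fin3 (c • n) p
  obtain ⟨d0, d1, d2⟩ := cross_fin3 n p
  ext i
  fin_cases i
  · simp only [Fin.zero_eta, Fin.isValue, c0, PiLp.smul_apply, smul_eq_mul, d0]; ring
  · simp only [Fin.mk_one, Fin.isValue, c1, PiLp.smul_apply, smul_eq_mul, d1]; ring
  · simp only [Fin.reduceFinMk, Fin.isValue, c2, PiLp.smul_apply, smul_eq_mul, d2]; ring

/-- **Zonal functional form from infinitesimal rotation invariance.**  If `H : ℝ³ → ℝ` is differentiable, homogeneous of degree `l`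
under positive dilations, and `⟪n × p, ∇H(p)⟫ = 0` for every `p` with `n ≠ 0`, then `H(y) = ‖y‖^l · g(⟪n, y⟫/‖y‖)` off the origin
for some `g : ℝ → ℝ` — the conclusion shape of `HorizonZonalitySingleDegree` / `HorizonTowerZonality`. [folklore] -/
theorem exists_zonalForm_of_inner_cross_gradient_eq_zero {H : E3 → ℝ} {n : E3} {l : ℕ} (hn : n ≠ 0)
    (hH : Differentiable ℝ H) (hhom : ∀ (c : ℝ) (y : E3), 0 < c → H (c • y) = c ^ l * H y)
    (hrot : ∀ p : E3, ⟪cross n p, gradient H p⟫ = 0) :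
    ∃ g : ℝ → ℝ, ∀ y : E3, y ≠ 0 → H y = ‖y‖ ^ l * g (⟪n, y⟫ / ‖y‖) := by
  classical
  -- unit axis
  have hnpos : 0 < ‖n‖ := norm_pos_iff.mpr hn
  have hm1 : ‖‖n‖⁻¹ • n‖ = 1 := by rw [norm_smul, norm_inv, norm_norm, inv_mul_cancel₀ hnpos.ne']
  have hrotm : ∀ p : E3, ⟪cross (‖n‖⁻¹ • n) p, gradient H p⟫ = 0 := by
    intro p
    rw [cross_smul_left, inner_smul_left, hrot p]
    simp
  refine ⟨fun t => if h : ∃ u : E3, ‖u‖ = 1 ∧ ⟪n, u⟫ = t then H h.choose else 0, fun y hy => ?_⟩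
  have hypos : 0 < ‖y‖ := norm_pos_iff.mpr hy
  have hu₀1 : ‖‖y‖⁻¹ • y‖ = 1 := by rw [norm_smul, norm_inv, norm_norm, inv_mul_cancel₀ hypos.ne']
  have hu₀n : ⟪n, ‖y‖⁻¹ • y⟫ = ⟪n, y⟫ / ‖y‖ := by rw [inner_smul_right]; ring
  have hex : ∃ u : E3, ‖u‖ = 1 ∧ ⟪n, u⟫ = ⟪n, y⟫ / ‖y‖ := ⟨‖y‖⁻¹ • y, hu₀1, hu₀n⟩
  simp only [hex, ↓reduceDIte]
  obtain ⟨hu1, hun⟩ := hex.choose_spec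
  -- same circle about the unit axis
  have hsame : H hex.choose = H (‖y‖⁻¹ • y) := by
    refine eq_of_inner_cross_gradient_eq_zero hH hrotm hm1 (by rw [hu1, hu₀1]) ?_
    rw [inner_smul_left, inner_smul_left, hun, hu₀n]
  have hyu : H y = H (‖y‖ • (‖y‖⁻¹ • y)) := by rw [smul_smul, mul_inv_cancel₀ hypos.ne', one_smul]
  rw [hsame, hyu]
  exact hhom ‖y‖ _ hypos

end Summit.NavierStokesRegularity.NavierStokesRegularity.Theorems.PoloidalLiouville.HorizonTower

end
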